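import Literature.MathematicalPhysics.QuantumFieldTheory.Balaban1983to89.B9Thm311InverseL2BoundsZd

/-!
# `Balaban1983to89.B9Thm31GreenPrimeGradientL2BoundZd` — [Balaban1985BackgroundPropagators] THM 3.1 p. 397, (3.42) AT `n = 1` IN THE `L²_τ` CURRENCY FOR `G′(U₀) = (Ω₀Δ′_a(U₀)Ω₀)⁻¹`
# AT THE `ℤᵈ × 𝔸` CARRIER: THE COVARIANT GRADIENT ENERGY `Σ_μ Σ_x |(D^η_{U₀,μ} G′(U₀)f)(x)|²_τ ≤ c′⁻¹·⟨f, f⟩_τ` FROM THE COERCIVITY CONSTANT `c′` OF `Ω₀Δ′_a(U₀)Ω₀` —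
# since the form (3.23)–(3.24) IS the gradient energy plus a non-negative penalty; ONE constant over the closed class (1.7) on `ℤᵈ` (this seat's `B9Thm31CoercivePrimeCompactZd`)

statement-level skeleton of published theorems with citation tags; proofs where landed; nothing here is a claim about the
Yang–Mills mass gap

`[Balaban1985BackgroundPropagators]` ("B9", CMP **99** (1985) 389–434) p. 394 (3.23)–(3.24): *«⟨λ, Δ′_a λ⟩ = Σ|D^η_U λ|² + Σ_j a_j(Lʲη)^{d−2} Σ|Q′_j λ|²»* (the quadratic form),
p. 397 Thm 3.1 with (3.42): *«|(∇^η_U)ⁿ G′(U; x, x′)| ≤ B₀(Lʲη)^{…} e^{−δ₀d(y,y′)} …, n = 0, 1, 2»* — the `n = 1` clause controls ONE covariant derivative of `G′`; this file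
gives its un-localised `L²` content from the coercivity constant alone (no expansion).  PDF held: `paper:balaban1985-cmp99-background-propagators` pp. 394–397 (re-read by this seat,
2026-08-28).

CITATION HEADER (lean-in-tree rule).  Cell `pub-ymgap` (YM Track A, D-0062 ∕ D-0149), node N06 = [B9], width seat `pub-ymgap-dag-n06-w4` (g4), CLAIM-11 ∕ INTENT-11.  Inputs BY NAME:
this seat's g2 `B9Eq324DeltaPrimeAZd` (`formE_deltaPrimeADom` — the form identity at a unitary background —, `GpZd`, `deltaPrimeADom_GpZd`), g4 `B9Thm311InverseL2BoundsZd`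
(`sq_le_mul_of_symm_nonneg`, `formE_GpZd_self_le_of_coercive`, `formE_self_nonneg'`), g4 `B9Thm31CoercivePrimeCompactZd.exists_coercive_formE_deltaPrimeADom_plaqClosed`.

WHAT IS PROVED (kernel, 0 sorry; theorems only — no `def`, `instance`, `notation`; generic `Ω₀ = s`, `m`, `a ≥ 0`, `Λ`; `0 < d`, `η ≠ 0`; Hermitian faithful tracial `τ` a PARAMETER).
* §1 `gradEnergy_nonneg`, ★ `gradEnergy_le_formE_deltaPrimeADom` (`Σ_μ Σ_x |(D^η_{U₀,μ}g)(x)|²_τ ≤ ⟨g, Ω₀Δ′_a(U₀)Ω₀ g⟩_τ` — the penalty is non-negative; every unitary `U₀`).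
* §2 ★★ `gradEnergy_GpZd_le_of_coercive` (`hco` with constant `c` ⟹ `Σ_μ Σ_x |(D^η_{U₀,μ}G′(U₀)f)(x)|²_τ ≤ c⁻¹·⟨f, f⟩_τ`: `= ⟨G′f, f⟩_τ ≤ ‖G′f‖_τ‖f‖_τ ≤ c⁻¹‖f‖²_τ`).
* §3 ★★★ `exists_gradEnergy_GpZd_le_plaqClosed` (ONE `c′` over the closed class (1.7) on `ℤᵈ`, `β < (α_Q∕L²)L^{−2m}`: the `n = 1` bound for EVERY unitary `U₀` with all plaquettes
  within `β` of `1`).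

HONEST SCOPE.  `L²_τ` gradient energy ONLY (no pointwise ∕ decay ∕ Hölder form of (3.42)–(3.43), no `n = 2`); constant NON-QUANTITATIVE (compactness); `τ` a PARAMETER; count-neutral
helper (`--supports` the K1 item of record); N05 ∕ N06 NOT discharged; K1 NOT closed; one finite `𝕋⁴` programme at fixed `ε`, Bałaban as printed; R4 closes only the conditional
finite-`𝕋⁴` rung `BalabanLadder.UV` — nothing continuum ∕ ℝ⁴ ∕ OS ∕ mass gap ∕ Clay.  Unit `pub-ymgap-dag-n06-w4` (g4), 2026-08-28.
-/

noncomputable section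

namespace Literature.MathematicalPhysics.QuantumFieldTheory.Balaban1983to89.B9Thm31GreenPrimeGradientL2BoundZd

open Filter Topology
open B7Prop1Explicit
open B7Prop2Explicit (unitaryUnits)
open B8Ineq132 (plaqF covDerivFwd)
open B7Eq78Linearization (QprimeIter zdBlocking)
open B8Eq119TwistedAxial (bgT)
open B9Eq316AveragingTransposeZd (Reg17 alphaQ)
open B9Eq321LandauProjectionZd (suppSub formE formE_isSymm)
open B9Eq324DeltaPrimeAZd (deltaPrimeADom GpZd deltaPrimeADom_GpZd formE_deltaPrimeADom)
open B9Thm311InverseL2BoundsZd (sq_le_mul_of_symm_nonneg formE_GpZd_self_le_of_coercive formE_self_nonneg')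
open B9Thm31CoercivePrimeCompactZd (exists_coercive_formE_deltaPrimeADom_plaqClosed)

export B7Prop1Explicit (Site)

variable {d : ℕ} {𝔸 : Type*} [CStarAlgebra 𝔸] [FiniteDimensional ℝ 𝔸]
variable (τ : 𝔸 →ₗ[ℂ] ℂ) (hτp : ∀ a : 𝔸, a ≠ 0 → 0 < (τ (star a * a)).re) {L : ℕ} {η : ℝ}
  (hτt : ∀ a b : 𝔸, τ (a * b) = τ (b * a)) (hτs : ∀ a : 𝔸, τ (star a) = starRingEnd ℂ (τ a))

/-! ## §1  The form (3.23)–(3.24) dominates the covariant gradient energy -/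

omit [FiniteDimensional ℝ 𝔸] in
include hτp in
/-- the covariant gradient energy `Σ_μ Σ_x Re τ((D^η_{U₀,μ}g)(x)* (D^η_{U₀,μ}g)(x))` is non-negative (faithful `τ`).
[cite: Balaban1985BackgroundPropagators, (3.23) p.394 («|D^η_U λ|²»)] -/
theorem gradEnergy_nonneg (U₀ : Site d → Fin d → 𝔸ˣ) (g : Site d → 𝔸) :
    0 ≤ ∑ μ : Fin d, ∑ᶠ x, (τ (star (covDerivFwd η U₀ μ g x) * covDerivFwd η U₀ μ g x)).re := by
  refine Finset.sum_nonneg fun μ _ => finsum_nonneg fun x => ?_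
  by_cases h : covDerivFwd η U₀ μ g x = 0
  · rw [h, mul_zero, map_zero, Complex.zero_re]
  · exact (hτp _ h).le

include hτt hτs in
/-- ★ **`Σ_μ Σ_x |(D^η_{U₀,μ}g)(x)|²_τ ≤ ⟨g, Ω₀Δ′_a(U₀)Ω₀ g⟩_τ`** at every unitary `U₀` for `a ≥ 0`: the form (3.23)–(3.24) is the gradient energy plus the non-negative penalty
`Σ_j a_j Σ_{y∈Λ_j} |(Q′_j g)(y)|²_τ`. [cite: Balaban1985BackgroundPropagators, (3.23)–(3.24) p.394] -/
theorem gradEnergy_le_formE_deltaPrimeADom (m : ℕ) {a : ℕ → ℝ} (ha : ∀ j, 0 ≤ a j) (Λ : ℕ → Finset (Site d)) (s : Finset (Site d))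
    {U₀ : Site d → Fin d → 𝔸ˣ} (hU : ∀ (x : Site d) (κ : Fin d), U₀ x κ ∈ unitaryUnits 𝔸) (g : suppSub (𝔸 := 𝔸) s) :
    ∑ μ : Fin d, ∑ᶠ x, (τ (star (covDerivFwd η U₀ μ (g : Site d → 𝔸) x) * covDerivFwd η U₀ μ (g : Site d → 𝔸) x)).re ≤
      formE τ s g (deltaPrimeADom L U₀ η τ hτp m a Λ s g) := by
  rw [formE_deltaPrimeADom (L := L) (m := m) (a := a) (Λ := Λ) τ hτp hτt hτs hU g g]
  have hpen : 0 ≤ ∑ j ∈ Finset.range (m + 1), a j * ∑ y ∈ Λ j,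
      (τ (star (QprimeIter (zdBlocking d L) (bgT L U₀) j (g : Site d → 𝔸) y) * QprimeIter (zdBlocking d L) (bgT L U₀) j (g : Site d → 𝔸) y)).re := by
    refine Finset.sum_nonneg fun j _ => mul_nonneg (ha j) (Finset.sum_nonneg fun y _ => ?_)
    by_cases h : QprimeIter (zdBlocking d L) (bgT L U₀) j (g : Site d → 𝔸) y = 0
    · rw [h, mul_zero, map_zero, Complex.zero_re]
    · exact (hτp _ h).le
  linarith

/-! ## §2  The `n = 1` bound for `G′(U₀)` from a coercivity constant -/

include hτt hτs in
/-- ★★ **(3.42) AT `n = 1` IN `L²_τ` FOR `G′(U₀)`, FROM A COERCIVITY CONSTANT**: if `c·⟨g, g⟩_τ ≤ ⟨g, Ω₀Δ′_a(U₀)Ω₀ g⟩_τ` for all `g` (`c > 0`), then for every `f ∈ L²(Ω₀, ·)`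
`Σ_μ Σ_x |(D^η_{U₀,μ}G′(U₀)f)(x)|²_τ ≤ c⁻¹·⟨f, f⟩_τ` — the gradient energy of `G′f` is `≤ ⟨G′f, Ω₀Δ′_aΩ₀ G′f⟩_τ = ⟨G′f, f⟩_τ ≤ ‖G′f‖_τ‖f‖_τ ≤ c⁻¹‖f‖²_τ`.
[cite: Balaban1985BackgroundPropagators, Thm 3.1 p.397, (3.42) p.397 (n = 1), (3.23)–(3.24) p.394; Balaban1984PropagatorsII, (2.22) p.226] -/
theorem gradEnergy_GpZd_le_of_coercive (hd : 0 < d) (hη : η ≠ 0) (m : ℕ) {a : ℕ → ℝ} (ha : ∀ j, 0 ≤ a j) (Λ : ℕ → Finset (Site d)) (s : Finset (Site d))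
    {U₀ : Site d → Fin d → 𝔸ˣ} (hU : ∀ (x : Site d) (κ : Fin d), U₀ x κ ∈ unitaryUnits 𝔸) {c : ℝ} (hc : 0 < c)
    (hco : ∀ g : suppSub (𝔸 := 𝔸) s, c * formE τ s g g ≤ formE τ s g (deltaPrimeADom L U₀ η τ hτp m a Λ s g)) (f : suppSub (𝔸 := 𝔸) s) :
    ∑ μ : Fin d, ∑ᶠ x, (τ (star (covDerivFwd η U₀ μ (GpZd L U₀ η τ hτp m a Λ s hd hη hτt hτs hU ha f : Site d → 𝔸) x) *
        covDerivFwd η U₀ μ (GpZd L U₀ η τ hτp m a Λ s hd hη hτt hτs hU ha f : Site d → 𝔸) x)).re ≤ c⁻¹ * formE τ s f f := by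
  set g := GpZd L U₀ η τ hτp m a Λ s hd hη hτt hτs hU ha f with hg
  -- gradient energy ≤ ⟨g, Δ′_a g⟩ = ⟨g, f⟩
  have h1 := gradEnergy_le_formE_deltaPrimeADom τ hτp hτt hτs m ha Λ s hU g (L := L) (η := η)
  rw [hg, deltaPrimeADom_GpZd hd hη hτt hτs hU ha f] at h1
  rw [hg]
  refine h1.trans ?_
  -- `⟨g, f⟩ ≤ c⁻¹ ⟨f, f⟩` by Cauchy–Schwarz and `⟨g, g⟩ ≤ c⁻² ⟨f, f⟩`
  have hsymm : ∀ v w : suppSub (𝔸 := 𝔸) s, formE τ s v w = formE τ s w v := fun v w => (formE_isSymm τ s hτs).eq v w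
  have hCS := sq_le_mul_of_symm_nonneg (formE τ s) hsymm (formE_self_nonneg' τ hτp s) g f
  have hgg := formE_GpZd_self_le_of_coercive τ hτp hτt hτs hd hη m ha Λ s hU hc hco f
  rw [← hg] at hgg
  have hff := formE_self_nonneg' τ hτp s f
  have hcinv : 0 < c⁻¹ := inv_pos.2 hc
  -- `(⟨g,f⟩)² ≤ ⟨g,g⟩⟨f,f⟩ ≤ c⁻²⟨f,f⟩²`, so `⟨g,f⟩ ≤ c⁻¹⟨f,f⟩`
  have hsq : (formE τ s g f) ^ 2 ≤ (c⁻¹ * formE τ s f f) ^ 2 := by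
    calc (formE τ s g f) ^ 2 ≤ formE τ s g g * formE τ s f f := hCS
      _ ≤ (c⁻¹ ^ 2 * formE τ s f f) * formE τ s f f := mul_le_mul_of_nonneg_right hgg hff
      _ = (c⁻¹ * formE τ s f f) ^ 2 := by ring
  have hb : 0 ≤ c⁻¹ * formE τ s f f := by positivity
  exact (le_abs_self _).trans (abs_le_of_sq_le_sq hsq hb)

/-! ## §3  One constant over the closed class (1.7) on `ℤᵈ` -/

include hτp hτt hτs in
/-- ★★★ **THE `n = 1` BOUND FOR `G′(U₀)` OVER THE CLOSED CLASS (1.7) ON `ℤᵈ`** (`[Nontrivial 𝔸]`, `2 ≤ L`): for every `β < (α_Q∕L²)·L^{−2m}` there is `c′ > 0` with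
`Σ_μ Σ_x |(D^η_{U₀,μ}G′(U₀)f)(x)|²_τ ≤ c′⁻¹·⟨f, f⟩_τ` for EVERY unitary `U₀` whose plaquettes are all within `β` of `1` and every `f ∈ L²(Ω₀, ·)`.
[cite: Balaban1985BackgroundPropagators, Thm 3.1 p.397, (3.42) p.397 (n = 1); Balaban1985RegularSpaces, (1.7) p.77] -/
theorem exists_gradEnergy_GpZd_le_plaqClosed [Nontrivial 𝔸] (hd : 0 < d) (hL : 2 ≤ L) (hη : η ≠ 0) (m : ℕ) {a : ℕ → ℝ} (ha : ∀ j, 0 ≤ a j)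
    (Λ : ℕ → Finset (Site d)) (s : Finset (Site d)) {β : ℝ} (hβ : β < alphaQ d L / (L : ℝ) ^ 2 * (((L : ℝ) ^ m)⁻¹) ^ 2) :
    ∃ c : ℝ, 0 < c ∧ ∀ (U₀ : Site d → Fin d → 𝔸ˣ) (hU₀ : ∀ x κ, U₀ x κ ∈ unitaryUnits 𝔸),
      (∀ (x : Site d) (μ ν : Fin d), ‖plaqF U₀ μ ν x - 1‖ ≤ β) → ∀ f : suppSub (𝔸 := 𝔸) s,
        ∑ μ : Fin d, ∑ᶠ x, (τ (star (covDerivFwd η U₀ μ (GpZd L U₀ η τ hτp m a Λ s hd hη hτt hτs hU₀ ha f : Site d → 𝔸) x) *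
            covDerivFwd η U₀ μ (GpZd L U₀ η τ hτp m a Λ s hd hη hτt hτs hU₀ ha f : Site d → 𝔸) x)).re ≤ c⁻¹ * formE τ s f f := by
  obtain ⟨c, hc, h⟩ := exists_coercive_formE_deltaPrimeADom_plaqClosed τ hτp hτt hτs hd hL hη m ha Λ s hβ
  exact ⟨c, hc, fun U₀ hU₀ hplaq f => gradEnergy_GpZd_le_of_coercive τ hτp hτt hτs hd hη m ha Λ s hU₀ hc (h U₀ hU₀ hplaq) f⟩

end Literature.MathematicalPhysics.QuantumFieldTheory.Balaban1983to89.B9Thm31GreenPrimeGradientL2BoundZd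

end
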